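import Summits.Ventures.CertifiedArithmetic.LowPrec.RoundToOdd
import Summits.Ventures.CertifiedArithmetic.LowPrec.AccumulateHeightFaithful

/-!
# Round-to-odd accumulation is faithful accumulation: the `2h·u` height bound applies

HONEST FRAMING (venture CertifiedArithmetic / cell `pub-lowprec`): certified error envelopes and
provably optimal rounding/accumulation schemes for low-precision formats under stated cost models;
every table by two implementations; no hardware or vendor claims.

`roundOdd α` (`RoundToOdd.lean`) is a FAITHFUL rounding: as a map on values it selects, at every
argument, either `roundDown α` or `roundUp α` (`toRat_roundOdd_eq_or`, both signs). Hence the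
lean seat's general faithful-accumulation theorem `abs_eval_faithful_sub_exact_le_height`
([LangeRump2018, Prop 3], faithful half, for the formats) applies verbatim: summing values of `α`
in ANY order with round to odd at every node, nodes in range, tree height `h` with
`(h+1)²·2u ≤ 1`, gives `|ŝ - s| ≤ 2h·u·Σ|xᵢ|` (`abs_eval_roundOdd_sub_exact_le_height`). So an
odd-rounded wide accumulation followed by one narrowing (innocuous by `RoundToOddDouble`) is
covered end to end by theorems of this tree.
-/

namespace Literature.ComputerArithmetic.FloatingPoint

namespace MiniFloat

open Format
open Literature.ComputerArithmetic.JeannerodRump2018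
open Literature.ComputerArithmetic.JeannerodRump2018.SumTree

variable {α : Format}

/-- `roundOdd` is a faithful selection: its value is `roundDown`'s or `roundUp`'s, at every
rational (negative arguments by the symmetry `RD(x) = -RU(-x)`). [cite: BoldoMelquiond2008, Thm 2] -/
theorem toRat_roundOdd_eq_or (s : ℚ) :
    (roundOdd α s).toRat = (roundDown α s).toRat ∨ (roundOdd α s).toRat = (roundUp α s).toRat := by
  rcases lt_or_ge s 0 with hs | hs
  · -- `s < 0`: `RO s = -RO(-s)`, `RD s = -RU(-s)`, `RU s = -RD(-s)`
    have hneg : (roundOdd α s).toRat = -(roundOddPos α (-s)).toRat := by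
      unfold roundOdd; rw [if_pos hs, toRat_flipSign]
    have hs0 : s ≠ 0 := ne_of_lt hs
    have hns0 : -s ≠ 0 := by intro h; apply hs0; linarith
    have hRU : (roundUp α s).toRat = -(roundDown α (-s)).toRat := toRat_roundUp_eq_neg hs0
    have hRD : (roundDown α s).toRat = -(roundUp α (-s)).toRat := by
      have := toRat_roundUp_eq_neg (φ := α) hns0
      rw [neg_neg] at this; linarith
    rcases roundOddPos_eq_or (φ := α) (-s) with h | h
    · right; rw [hneg, h, hRU]
    · left; rw [hneg, h, hRD]
  · rw [roundOdd_of_nonneg hs]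
    rcases roundOddPos_eq_or (φ := α) s with h | h
    · left; rw [h]
    · right; rw [h]

/-- ROUND-TO-ODD ACCUMULATION, ANY ORDER: leaves values of `α`, every node in range, `emaxCode ≥ 2`,
height `h` with `(h+1)²·2u ≤ 1` ⟹ `|ŝ - s| ≤ h·2u·Σ|xᵢ|` — the faithful half of
[LangeRump2018, Prop 3] (`abs_eval_faithful_sub_exact_le_height`) instantiated at the selection
`roundOdd α`. [cite: LangeRump2018, Prop 3] -/
theorem abs_eval_roundOdd_sub_exact_le_height (hα : 2 ≤ α.emaxCode) (t : SumTree)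
    (ht : TreeInRangeWith α (fun s => (roundOdd α s).toRat) t)
    (hh : ((treeHeight t : ℚ) + 1) ^ 2 * (2 * α.unitRoundoff) ≤ 1) :
    |SumTree.eval (fun s => (roundOdd α s).toRat) t - SumTree.exact t|
      ≤ (treeHeight t : ℚ) * (2 * α.unitRoundoff) * absSum t :=
  abs_eval_faithful_sub_exact_le_height hα _ (fun s => toRat_roundOdd_eq_or s) t ht hh

/-- Kernel illustration (bfloat16, sequential order): `RO(RO(1 + u) + u)` with `u = 2⁻⁸`:
`1 + u ∉ F` ↦ the odd neighbour `1 + 2u`; then `1 + 3u ∉ F` ↦ the odd neighbour… `1 + 2u` again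
(`1 + 4u` is even): round to odd STICKS at odd values where RNE would alternate. Error `2u` on a
sum `1 + 2u·…`, within the bound. -/
example :
    (roundOdd Format.BFloat16 ((roundOdd Format.BFloat16 (1 + 1 / 256)).toRat + 1 / 256)).toRat
      = 1 + 2 / 256 := by
  decide +kernel

end MiniFloat

end Literature.ComputerArithmetic.FloatingPoint
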